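import Literature.NumberTheory.Automorphic.GodementJacquetZetaKernelTheta
import Literature.NumberTheory.Automorphic.AutomorphicKernelBruhat
import HarnessLib

/-!
# The reflection identity for the truncated Godement–Jacquet zeta integral

Topic `NumberTheory/Automorphic`; namespace `Literature.NumberTheory.Automorphic`. The central
identity of the discharge of `GodementJacquet1972_gjZeta_meromorphic` (Godement–Jacquet, LNM 260
(1972), §12–13: unfold `Z^{<1}` over `GL_n(K) A_G \ GL_n(𝔸)`, apply Poisson summation to the
theta series fibrewise, and refold the regular part of the dual theta series into the zeta integral
of `Φ̂` at `n - s`). With the Bruhat-function form of the unfolded bilinear form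
(`AutomorphicKernelBruhat`), the kernels of `GLnZetaKernel` / `GodementJacquetZetaKernelTheta` and the
reflection formula of `GodementJacquetThetaSeries`:

* `integrable_tsum_arith_of_integrable_fiber`, `integrable_gjTruncF_one_mul_gjThetaReg`,
  `integrable_gjDualF_one_mul_gjThetaReg` — on an integrable fibre the `A_G`-integrands
  `ω_s(x̃ a ỹ⁻¹) Θ_Φ^reg(x̃, a ỹ⁻¹)` and `ω'_{n-s}(ỹ a⁻¹ x̃⁻¹) Θ_{Φ̂}^reg(ỹ a⁻¹, x̃⁻¹)` are integrable;
* `cosetKernel_gjDualF_inv_eq_smul_integral` — **the kernel of `F'' = F'_{n-s} ∘ inv`**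
  (`F' = Φ̂ |det|^{n-s} 𝟙_{|det|>1}`): `K_{F''}(x̃, ỹH) = κ ∫_{A_G} ω'(ỹ a⁻¹ x̃⁻¹) Θ_{Φ̂}^reg(ỹ a⁻¹, x̃⁻¹) dα`
  — the test function `F''` is chosen so that the dual term `∫_G F''(g) ⟪φ', R(g) φ⟫ dg` unfolds in
  the *same* variables as `Z^{<1}`, and no interchange of the two quotient variables is needed;
* `gjSingDefect` (**definition**) — the singular defect
  `(Q' - Q)(x̃, ỹ, a) = λ(D_M)⁻¹ ω'_{n-s}(ỹ a⁻¹ x̃⁻¹) Θ_{Φ̂}^sing(ỹ a⁻¹, x̃⁻¹) - ω_s(x̃ a ỹ⁻¹) Θ_Φ^sing(x̃, a ỹ⁻¹)`;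
  `cosetKernel_gjTruncF_sub_eq_smul_integral_gjSingDefect` — **pointwise,
  `K_{F_s^<}(x̃, ỹH) - λ(D_M)⁻¹ K_{F''}(x̃, ỹH) = κ ∫_{A_G} (Q' - Q) dα`** (the regular parts cancel by
  Poisson summation), with integrability of the defect;
* `gjZeta_restrict_compl_sub_dual_eq_integral_gjSingDefect` — **the reflection identity**: for
  `Φ ∈ 𝒮(M_n(𝔸_K))`, all `φ, φ' ∈ L²(X)`, `Re s ≥ n² + n + 2`, a Bruhat function `β` of
  `H = A_G · GL_n(K)`:
  `Z^{<1}(Φ, s, φ, φ') - λ(D_M)⁻¹ ∫_G F''(g) ⟪φ', R(g) φ⟫ dν(g)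
     = c ∫_G β(x̃) conj φ'(x̃H) ∫_G β(ỹ) (κ ∫_{A_G} (Q' - Q)(x̃, ỹ, a) dα) φ(ỹH) dν(ỹ) dν(x̃)`,
  with **no hypothesis on the singular terms** (their combination is integrable as a difference of
  kernels). For `n = 1` the right-hand side is explicit (Tate's polar terms, `GodementJacquetRankOne`);
  for `n ≥ 2` it vanishes on cusp forms.

## References

* R. Godement, H. Jacquet, *Zeta functions of simple algebras*, LNM 260 (1972), §12–13
  [GodementJacquet1972].
* H. Jacquet, *Principal L-functions of the linear group*, Proc. Sympos. Pure Math. 33.2 (1979), §4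
  [folklore].
-/

noncomputable section

open MeasureTheory Measure Set Filter Topology IsDedekindDomain NumberField
open Literature.MeasureTheory.Group
open scoped ENNReal NNReal ComplexConjugate MatrixGroups

namespace Literature.NumberTheory.Automorphic

-- the quotient carries the tree's Borel σ-algebra, not Mathlib's quotient σ-algebra
attribute [-instance] Quotient.instMeasurableSpace QuotientGroup.measurableSpace

/-! ### Fibrewise: integrability in `a ∈ A_G` and the dual kernel -/

section Fibre

variable {n : ℕ} {K : Type} [Field K] [NumberField K]

attribute [local instance] adelicBorel borelSpace_adelic locallyCompactSpace_adelic
  secondCountableTopology_gl_adelic measurableSpaceQuotient borelSpaceQuotient glBorel borelSpace_glBorel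
  isHaarMeasure_glForm

variable {ρ : Measure (AdelicGroupData.gl n K).quotientSubgroup} [ρ.IsHaarMeasure]
  {α : Measure (AdelicGroupData.gl n K).center'} [α.IsHaarMeasure] [α.IsInvInvariant] {κ : ℝ≥0}
  (hκ : ρ.map (quotientSubgroupEquiv n K) =
    κ • α.prod (count : Measure (AdelicGroupData.gl n K).arithmeticSubgroup))

include hκ in
/-- **The fibre sum of an integrable fibre is integrable over `A_G`**: if
`h ↦ F(x̃ h⁻¹ ỹ⁻¹)` is `ρ_H`-integrable then `a ↦ Σ_γ F(x̃ γ a ỹ⁻¹)` is `α`-integrable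
(`integral_quotientSubgroup_eq_smul_integral_tsum`, `γ ↦ γ⁻¹`, `a ↦ a⁻¹`). [folklore] -/
theorem integrable_tsum_arith_of_integrable_fiber (F : (AdelicGroupData.gl n K).Adelic → ℂ)
    (x₀ y₀ : (AdelicGroupData.gl n K).Adelic)
    (hF : Integrable (fun h : (AdelicGroupData.gl n K).quotientSubgroup =>
      F (x₀ * ((h : (AdelicGroupData.gl n K).Adelic))⁻¹ * y₀⁻¹)) ρ) :
    Integrable (fun a : (AdelicGroupData.gl n K).center' =>
      ∑' γ : (AdelicGroupData.gl n K).arithmeticSubgroup,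
        F (x₀ * (γ : (AdelicGroupData.gl n K).Adelic) * (a : (AdelicGroupData.gl n K).Adelic) * y₀⁻¹)) α := by
  obtain ⟨-, h2, -⟩ := integral_quotientSubgroup_eq_smul_integral_tsum hκ hF
  have hsum : ∀ a : (AdelicGroupData.gl n K).center',
      ∑' γ : (AdelicGroupData.gl n K).arithmeticSubgroup,
          F (x₀ * (((quotientSubgroupEquiv n K).symm (a, γ) : (AdelicGroupData.gl n K).quotientSubgroup) :
            (AdelicGroupData.gl n K).Adelic)⁻¹ * y₀⁻¹) =
        ∑' γ : (AdelicGroupData.gl n K).arithmeticSubgroup,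
          F (x₀ * (γ : (AdelicGroupData.gl n K).Adelic) * ((a : (AdelicGroupData.gl n K).Adelic))⁻¹ * y₀⁻¹) := by
    intro a
    rw [← (Equiv.inv (AdelicGroupData.gl n K).arithmeticSubgroup).tsum_eq]
    refine tsum_congr fun γ => ?_
    simp only [Equiv.inv_apply, coe_quotientSubgroupEquiv_symm_apply, Subgroup.coe_inv, mul_inv_rev,
      inv_inv, mul_assoc]
  simp_rw [hsum] at h2
  have h3 := h2.comp_inv
  refine h3.congr (Eventually.of_forall fun a => ?_)
  simp only [Subgroup.coe_inv, inv_inv]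

include hκ in
/-- **`a ↦ ω_s(x̃ a ỹ⁻¹) Θ_Φ^reg(x̃, a ỹ⁻¹)` is `α`-integrable** on a fibre where
`h ↦ F_s^<(x̃ h⁻¹ ỹ⁻¹)` is `ρ_H`-integrable. [folklore] -/
theorem integrable_gjTruncF_one_mul_gjThetaReg (Φ : Matrix (Fin n) (Fin n) (AdeleRing (𝓞 K) K) → ℂ)
    (s : ℂ) (x₀ y₀ : (AdelicGroupData.gl n K).Adelic)
    (hF : Integrable (fun h : (AdelicGroupData.gl n K).quotientSubgroup =>
      gjTruncF n K Φ s (x₀ * ((h : (AdelicGroupData.gl n K).Adelic))⁻¹ * y₀⁻¹)) ρ) :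
    Integrable (fun a : (AdelicGroupData.gl n K).center' =>
      gjTruncF n K (fun _ => (1 : ℂ)) s (x₀ * (a : (AdelicGroupData.gl n K).Adelic) * y₀⁻¹) *
        gjThetaReg n K Φ x₀ ((a : (AdelicGroupData.gl n K).Adelic) * y₀⁻¹)) α := by
  refine (integrable_tsum_arith_of_integrable_fiber hκ (gjTruncF n K Φ s) x₀ y₀ hF).congr
    (Eventually.of_forall fun a => ?_)
  exact tsum_gjTruncF_arith_eq_mul_gjThetaReg Φ s x₀ (a : (AdelicGroupData.gl n K).Adelic) y₀⁻¹

include hκ in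
/-- **The dual fibre: `a ↦ ω'_w(ỹ a⁻¹ x̃⁻¹) Θ_Ψ^reg(ỹ a⁻¹, x̃⁻¹)` is `α`-integrable** on a fibre where
`h ↦ F''(x̃ h⁻¹ ỹ⁻¹) = F'_w(ỹ h x̃⁻¹)` is `ρ_H`-integrable (`F'' = F'_w ∘ inv`). [folklore] -/
theorem integrable_gjDualF_one_mul_gjThetaReg (Ψ : Matrix (Fin n) (Fin n) (AdeleRing (𝓞 K) K) → ℂ)
    (w : ℂ) (x₀ y₀ : (AdelicGroupData.gl n K).Adelic)
    (hF : Integrable (fun h : (AdelicGroupData.gl n K).quotientSubgroup =>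
      (fun g : (AdelicGroupData.gl n K).Adelic => gjDualF n K Ψ w (g⁻¹ : (AdelicGroupData.gl n K).Adelic))
        (x₀ * ((h : (AdelicGroupData.gl n K).Adelic))⁻¹ * y₀⁻¹)) ρ) :
    Integrable (fun a : (AdelicGroupData.gl n K).center' =>
      gjDualF n K (fun _ => (1 : ℂ)) w (y₀ * ((a : (AdelicGroupData.gl n K).Adelic))⁻¹ * x₀⁻¹) *
        gjThetaReg n K Ψ (y₀ * ((a : (AdelicGroupData.gl n K).Adelic))⁻¹) x₀⁻¹) α := by
  have h := integrable_tsum_arith_of_integrable_fiber hκ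
    (fun g : (AdelicGroupData.gl n K).Adelic => gjDualF n K Ψ w (g⁻¹ : (AdelicGroupData.gl n K).Adelic)) x₀ y₀ hF
  refine h.congr (Eventually.of_forall fun a => ?_)
  -- `(x̃ γ a ỹ⁻¹)⁻¹ = ỹ a⁻¹ γ⁻¹ x̃⁻¹`; reindex `γ ↦ γ⁻¹` and use the dual fibre sum with `(y, a, b) = (ỹ a⁻¹, 1, x̃⁻¹)`
  have h1 : ∑' γ : (AdelicGroupData.gl n K).arithmeticSubgroup,
      gjDualF n K Ψ w ((x₀ * (γ : (AdelicGroupData.gl n K).Adelic) * (a : (AdelicGroupData.gl n K).Adelic) * y₀⁻¹)⁻¹ :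
        (AdelicGroupData.gl n K).Adelic) =
      ∑' γ : (AdelicGroupData.gl n K).arithmeticSubgroup,
        gjDualF n K Ψ w (y₀ * ((a : (AdelicGroupData.gl n K).Adelic))⁻¹ *
          (γ : (AdelicGroupData.gl n K).Adelic) * x₀⁻¹) := by
    rw [← (Equiv.inv (AdelicGroupData.gl n K).arithmeticSubgroup).tsum_eq]
    refine tsum_congr fun γ => ?_
    simp only [Equiv.inv_apply, Subgroup.coe_inv, mul_inv_rev, inv_inv, mul_assoc]
  have h2 := tsum_gjDualF_arith_eq_mul_gjThetaReg Ψ w (y₀ * ((a : (AdelicGroupData.gl n K).Adelic))⁻¹)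
    (1 : (AdelicGroupData.gl n K).Adelic) x₀⁻¹
  simp only [mul_one, one_mul] at h2
  exact h1.trans h2

include hκ in
/-- **The kernel of the inverted dual test function** `F'' = F'_w ∘ inv` on an integrable fibre:
`K_{F''}(x̃, ỹH) = κ ∫_{A_G} ω'_w(ỹ a⁻¹ x̃⁻¹) Θ_Ψ^reg(ỹ a⁻¹, x̃⁻¹) dα(a)` — the dual regular term
of the pointwise reflection formula, integrated. [cite: GodementJacquet1972, §12] -/
theorem cosetKernel_gjDualF_inv_eq_smul_integral (Ψ : Matrix (Fin n) (Fin n) (AdeleRing (𝓞 K) K) → ℂ)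
    (w : ℂ) (x₀ y₀ : (AdelicGroupData.gl n K).Adelic)
    (hF : Integrable (fun h : (AdelicGroupData.gl n K).quotientSubgroup =>
      (fun g : (AdelicGroupData.gl n K).Adelic => gjDualF n K Ψ w (g⁻¹ : (AdelicGroupData.gl n K).Adelic))
        (x₀ * ((h : (AdelicGroupData.gl n K).Adelic))⁻¹ * y₀⁻¹)) ρ) :
    cosetKernel (AdelicGroupData.gl n K).quotientSubgroup ρ
        (fun g : (AdelicGroupData.gl n K).Adelic => gjDualF n K Ψ w (g⁻¹ : (AdelicGroupData.gl n K).Adelic)) x₀ (QuotientGroup.mk y₀) =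
      (κ : ℝ) • ∫ a : (AdelicGroupData.gl n K).center',
        gjDualF n K (fun _ => (1 : ℂ)) w (y₀ * ((a : (AdelicGroupData.gl n K).Adelic))⁻¹ * x₀⁻¹) *
          gjThetaReg n K Ψ (y₀ * ((a : (AdelicGroupData.gl n K).Adelic))⁻¹) x₀⁻¹ ∂α := by
  rw [cosetKernel_quotientSubgroup_eq_smul_integral_tsum hκ
    (fun g : (AdelicGroupData.gl n K).Adelic => gjDualF n K Ψ w (g⁻¹ : (AdelicGroupData.gl n K).Adelic)) x₀ y₀ hF]
  congr 1
  refine integral_congr_ae (Eventually.of_forall fun a => ?_)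
  have h1 : ∑' γ : (AdelicGroupData.gl n K).arithmeticSubgroup,
      gjDualF n K Ψ w ((x₀ * (γ : (AdelicGroupData.gl n K).Adelic) * (a : (AdelicGroupData.gl n K).Adelic) * y₀⁻¹)⁻¹ :
        (AdelicGroupData.gl n K).Adelic) =
      ∑' γ : (AdelicGroupData.gl n K).arithmeticSubgroup,
        gjDualF n K Ψ w (y₀ * ((a : (AdelicGroupData.gl n K).Adelic))⁻¹ *
          (γ : (AdelicGroupData.gl n K).Adelic) * x₀⁻¹) := by
    rw [← (Equiv.inv (AdelicGroupData.gl n K).arithmeticSubgroup).tsum_eq]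
    refine tsum_congr fun γ => ?_
    simp only [Equiv.inv_apply, Subgroup.coe_inv, mul_inv_rev, inv_inv, mul_assoc]
  have h2 := tsum_gjDualF_arith_eq_mul_gjThetaReg Ψ w (y₀ * ((a : (AdelicGroupData.gl n K).Adelic))⁻¹)
    (1 : (AdelicGroupData.gl n K).Adelic) x₀⁻¹
  simp only [mul_one, one_mul] at h2
  exact h1.trans h2

/-- `F'_w` is strongly measurable. [folklore] -/
theorem stronglyMeasurable_gjDualF {Ψ : Matrix (Fin n) (Fin n) (AdeleRing (𝓞 K) K) → ℂ}
    (hΨ : Ψ ∈ schwartzBruhatAdelicMatrix n K) (w : ℂ) :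
    StronglyMeasurable (gjDualF n K Ψ w : (AdelicGroupData.gl n K).Adelic → ℂ) := by
  have hc : Continuous fun u : GL (Fin n) (AdeleRing (𝓞 K) K) =>
      Ψ (u : Matrix (Fin n) (Fin n) (AdeleRing (𝓞 K) K)) * ((adelicAbsDet n K u : ℝ) : ℂ) ^ w :=
    ((continuous_of_mem_schwartzBruhatAdelicMatrix hΨ).comp Units.continuous_val).mul
      (continuous_adelicAbsDet_cpow w)
  exact hc.stronglyMeasurable.indicator (isOpen_detGtOne (n := n) (K := K)).measurableSet

/-- `F_s^<` is strongly measurable. [folklore] -/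
theorem stronglyMeasurable_gjTruncF {Φ : Matrix (Fin n) (Fin n) (AdeleRing (𝓞 K) K) → ℂ}
    (hΦ : Φ ∈ schwartzBruhatAdelicMatrix n K) (s : ℂ) :
    StronglyMeasurable (gjTruncF n K Φ s : (AdelicGroupData.gl n K).Adelic → ℂ) := by
  have hc : Continuous fun g : GL (Fin n) (AdeleRing (𝓞 K) K) =>
      Φ (g : Matrix (Fin n) (Fin n) (AdeleRing (𝓞 K) K)) * ((adelicAbsDet n K g : ℝ) : ℂ) ^ s :=
    ((continuous_of_mem_schwartzBruhatAdelicMatrix hΦ).comp Units.continuous_val).mul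
      (continuous_adelicAbsDet_cpow s)
  exact hc.stronglyMeasurable.indicator (measurableSet_detAtLeastOne (n := n) (K := K)).compl


end Fibre

/-! ### The singular defect and the pointwise identity `K_F - λ⁻¹ K_{F''} = κ ∫_{A_G} (Q' - Q)` -/

section Defect

variable {n : ℕ} {K : Type} [Field K] [NumberField K]

attribute [local instance] adelicBorel borelSpace_adelic locallyCompactSpace_adelic
  secondCountableTopology_gl_adelic measurableSpaceQuotient borelSpaceQuotient glBorel borelSpace_glBorel
  isHaarMeasure_glForm

variable [MeasurableSpace (AdeleRing (𝓞 K) K)] [BorelSpace (AdeleRing (𝓞 K) K)]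
  [MeasurableSpace (Matrix (Fin n) (Fin n) (AdeleRing (𝓞 K) K))]
  [BorelSpace (Matrix (Fin n) (Fin n) (AdeleRing (𝓞 K) K))]
  (lam : Measure (Matrix (Fin n) (Fin n) (AdeleRing (𝓞 K) K))) [lam.IsAddHaarMeasure] [lam.Regular]

/-- **The singular defect integrand** of the reflection formula at `(x̃, ỹ, a)`:
`λ(D_M)⁻¹ ω'_{n-s}(ỹ a⁻¹ x̃⁻¹) Θ_{Φ̂}^sing(ỹ a⁻¹, x̃⁻¹) - ω_s(x̃ a ỹ⁻¹) Θ_Φ^sing(x̃, a ỹ⁻¹)`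
(`Q' - Q` in the notation of the module docstring; for `n = 1` it is
`λ⁻¹ ω'_{1-s}(ỹ a⁻¹ x̃⁻¹) Φ̂(0) - ω_s(x̃ a ỹ⁻¹) Φ(0)`, for `n ≥ 2` its integral against cusp forms
vanishes). [cite: GodementJacquet1972, §12] -/
def gjSingDefect (Φ : Matrix (Fin n) (Fin n) (AdeleRing (𝓞 K) K) → ℂ) (s : ℂ)
    (x₀ y₀ : (AdelicGroupData.gl n K).Adelic) (a : (AdelicGroupData.gl n K).center') : ℂ :=
  ((lam (matrixFundamentalDomain n K)).toReal : ℂ)⁻¹ *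
      (gjDualF n K (fun _ => (1 : ℂ)) ((n : ℂ) - s) (y₀ * ((a : (AdelicGroupData.gl n K).Adelic))⁻¹ * x₀⁻¹) *
        gjThetaSing n K (adelicMatrixFourier n K lam Φ) (y₀ * ((a : (AdelicGroupData.gl n K).Adelic))⁻¹) x₀⁻¹) -
    gjTruncF n K (fun _ => (1 : ℂ)) s (x₀ * (a : (AdelicGroupData.gl n K).Adelic) * y₀⁻¹) *
      gjThetaSing n K Φ x₀ ((a : (AdelicGroupData.gl n K).Adelic) * y₀⁻¹)

/-- The pointwise reflection formula in the variables of the kernels (products in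
`(AdelicGroupData.gl n K).Adelic`): `P = λ⁻¹ P̃' + (Q' - Q)`. [folklore] -/
theorem gjTruncF_one_mul_gjThetaReg_eq_add_gjSingDefect
    {Φ : Matrix (Fin n) (Fin n) (AdeleRing (𝓞 K) K) → ℂ} (hΦ : Φ ∈ schwartzBruhatAdelicMatrix n K) (s : ℂ)
    (x₀ y₀ : (AdelicGroupData.gl n K).Adelic) (a : (AdelicGroupData.gl n K).center') :
    gjTruncF n K (fun _ => (1 : ℂ)) s (x₀ * (a : (AdelicGroupData.gl n K).Adelic) * y₀⁻¹) *
        gjThetaReg n K Φ x₀ ((a : (AdelicGroupData.gl n K).Adelic) * y₀⁻¹) =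
      ((lam (matrixFundamentalDomain n K)).toReal : ℂ)⁻¹ *
        (gjDualF n K (fun _ => (1 : ℂ)) ((n : ℂ) - s) (y₀ * ((a : (AdelicGroupData.gl n K).Adelic))⁻¹ * x₀⁻¹) *
          gjThetaReg n K (adelicMatrixFourier n K lam Φ) (y₀ * ((a : (AdelicGroupData.gl n K).Adelic))⁻¹) x₀⁻¹) +
      gjSingDefect lam Φ s x₀ y₀ a := by
  -- the `GL`-typed reflection lemma, read in the `Adelic`-typed products of this file
  have h : gjTruncF n K (fun _ => (1 : ℂ)) s (x₀ * (a : (AdelicGroupData.gl n K).Adelic) * y₀⁻¹) *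
        gjThetaReg n K Φ x₀ ((a : (AdelicGroupData.gl n K).Adelic) * y₀⁻¹) =
      (lam (matrixFundamentalDomain n K)).toReal⁻¹ *
        (gjDualF n K (fun _ => (1 : ℂ)) ((n : ℂ) - s) (y₀ * ((a : (AdelicGroupData.gl n K).Adelic))⁻¹ * x₀⁻¹) *
          (gjThetaReg n K (adelicMatrixFourier n K lam Φ) (y₀ * ((a : (AdelicGroupData.gl n K).Adelic))⁻¹) x₀⁻¹ +
            gjThetaSing n K (adelicMatrixFourier n K lam Φ) (y₀ * ((a : (AdelicGroupData.gl n K).Adelic))⁻¹) x₀⁻¹)) -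
        gjTruncF n K (fun _ => (1 : ℂ)) s (x₀ * (a : (AdelicGroupData.gl n K).Adelic) * y₀⁻¹) *
          gjThetaSing n K Φ x₀ ((a : (AdelicGroupData.gl n K).Adelic) * y₀⁻¹) :=
    gjTruncF_one_mul_gjThetaReg_eq_reflection lam hΦ s x₀ (a : (AdelicGroupData.gl n K).Adelic) y₀
  rw [h, gjSingDefect, Complex.ofReal_inv]
  ring

variable {ρ : Measure (AdelicGroupData.gl n K).quotientSubgroup} [ρ.IsHaarMeasure]
  {α : Measure (AdelicGroupData.gl n K).center'} [α.IsHaarMeasure] [α.IsInvInvariant] {κ : ℝ≥0}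
  (hκ : ρ.map (quotientSubgroupEquiv n K) =
    κ • α.prod (count : Measure (AdelicGroupData.gl n K).arithmeticSubgroup))

include hκ in
/-- **The pointwise identity behind the reflection formula**: on a fibre `(x̃, ỹ)` where both
`h ↦ F_s^<(x̃ h⁻¹ ỹ⁻¹)` and `h ↦ F''(x̃ h⁻¹ ỹ⁻¹)` (`F'' = F'_{n-s} ∘ inv`, `F' = Φ̂ |det|^{n-s} 𝟙_{>1}`)
are `ρ_H`-integrable, the singular defect is `α`-integrable in `a` and
`K_{F_s^<}(x̃, ỹH) - λ(D_M)⁻¹ K_{F''}(x̃, ỹH) = κ ∫_{A_G} (Q' - Q)(x̃, ỹ, a) dα(a)`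
(the regular parts cancel by Poisson summation: `gjTruncF_one_mul_gjThetaReg_eq_add_gjSingDefect`
integrated over `A_G`). [cite: GodementJacquet1972, §12] -/
theorem cosetKernel_gjTruncF_sub_eq_smul_integral_gjSingDefect
    {Φ : Matrix (Fin n) (Fin n) (AdeleRing (𝓞 K) K) → ℂ} (hΦ : Φ ∈ schwartzBruhatAdelicMatrix n K) (s : ℂ)
    (x₀ y₀ : (AdelicGroupData.gl n K).Adelic)
    (hF : Integrable (fun h : (AdelicGroupData.gl n K).quotientSubgroup =>
      gjTruncF n K Φ s (x₀ * ((h : (AdelicGroupData.gl n K).Adelic))⁻¹ * y₀⁻¹)) ρ)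
    (hF'' : Integrable (fun h : (AdelicGroupData.gl n K).quotientSubgroup =>
      (fun g : (AdelicGroupData.gl n K).Adelic =>
          gjDualF n K (adelicMatrixFourier n K lam Φ) ((n : ℂ) - s) (g⁻¹ : (AdelicGroupData.gl n K).Adelic))
        (x₀ * ((h : (AdelicGroupData.gl n K).Adelic))⁻¹ * y₀⁻¹)) ρ) :
    Integrable (gjSingDefect lam Φ s x₀ y₀) α ∧
      cosetKernel (AdelicGroupData.gl n K).quotientSubgroup ρ (gjTruncF n K Φ s) x₀ (QuotientGroup.mk y₀) -
          ((lam (matrixFundamentalDomain n K)).toReal : ℂ)⁻¹ *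
            cosetKernel (AdelicGroupData.gl n K).quotientSubgroup ρ
              (fun g : (AdelicGroupData.gl n K).Adelic =>
                gjDualF n K (adelicMatrixFourier n K lam Φ) ((n : ℂ) - s) (g⁻¹ : (AdelicGroupData.gl n K).Adelic))
                x₀ (QuotientGroup.mk y₀) =
        (κ : ℝ) • ∫ a, gjSingDefect lam Φ s x₀ y₀ a ∂α := by
  have hP := integrable_gjTruncF_one_mul_gjThetaReg hκ Φ s x₀ y₀ hF
  have hPP := integrable_gjDualF_one_mul_gjThetaReg hκ (adelicMatrixFourier n K lam Φ) ((n : ℂ) - s) x₀ y₀ hF''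
  have hPP' := hPP.const_mul (((lam (matrixFundamentalDomain n K)).toReal : ℂ)⁻¹)
  have hdiff := hP.sub hPP'
  have hD : Integrable (gjSingDefect lam Φ s x₀ y₀) α := by
    refine hdiff.congr (Eventually.of_forall fun a => ?_)
    change gjTruncF n K (fun _ => (1 : ℂ)) s (x₀ * (a : (AdelicGroupData.gl n K).Adelic) * y₀⁻¹) *
        gjThetaReg n K Φ x₀ ((a : (AdelicGroupData.gl n K).Adelic) * y₀⁻¹) - _ = gjSingDefect lam Φ s x₀ y₀ a
    rw [gjTruncF_one_mul_gjThetaReg_eq_add_gjSingDefect lam hΦ s x₀ y₀ a]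
    ring
  refine ⟨hD, ?_⟩
  rw [cosetKernel_gjTruncF_eq_smul_integral_gjThetaReg hκ Φ s x₀ y₀ hF,
    cosetKernel_gjDualF_inv_eq_smul_integral hκ (adelicMatrixFourier n K lam Φ) ((n : ℂ) - s) x₀ y₀ hF'',
    Complex.real_smul, Complex.real_smul, Complex.real_smul]
  rw [show ∀ A B : ℂ, (κ : ℂ) * A - ((lam (matrixFundamentalDomain n K)).toReal : ℂ)⁻¹ * ((κ : ℂ) * B) =
      (κ : ℂ) * (A - ((lam (matrixFundamentalDomain n K)).toReal : ℂ)⁻¹ * B) from fun A B => by ring,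
    ← integral_const_mul (((lam (matrixFundamentalDomain n K)).toReal : ℂ)⁻¹), ← integral_sub hP hPP']
  congr 1
  refine integral_congr_ae (Eventually.of_forall fun a => ?_)
  change gjTruncF n K (fun _ => (1 : ℂ)) s (x₀ * (a : (AdelicGroupData.gl n K).Adelic) * y₀⁻¹) *
      gjThetaReg n K Φ x₀ ((a : (AdelicGroupData.gl n K).Adelic) * y₀⁻¹) - _ = gjSingDefect lam Φ s x₀ y₀ a
  rw [gjTruncF_one_mul_gjThetaReg_eq_add_gjSingDefect lam hΦ s x₀ y₀ a]
  ring

end Defect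

/-! ### The reflection identity, integrated over `X × X` through a Bruhat function -/

section Integrated

variable {n : ℕ} {K : Type} [Field K] [NumberField K]

attribute [local instance] adelicBorel borelSpace_adelic locallyCompactSpace_adelic
  secondCountableTopology_gl_adelic measurableSpaceQuotient borelSpaceQuotient glBorel borelSpace_glBorel
  isHaarMeasure_glForm

variable [MeasurableSpace (AdeleRing (𝓞 K) K)] [BorelSpace (AdeleRing (𝓞 K) K)]
  [MeasurableSpace (Matrix (Fin n) (Fin n) (AdeleRing (𝓞 K) K))]
  [BorelSpace (Matrix (Fin n) (Fin n) (AdeleRing (𝓞 K) K))]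
  (lam : Measure (Matrix (Fin n) (Fin n) (AdeleRing (𝓞 K) K))) [lam.IsAddHaarMeasure] [lam.Regular]
  (μ : Measure (AdelicGroupData.gl n K).automorphicQuotient)
  [(AdelicGroupData.gl n K).IsAutomorphicMeasure μ]
  (ν : Measure (AdelicGroupData.gl n K).Adelic) [ν.IsHaarMeasure]

attribute [local instance] smulInvariantMeasureQuotient isFiniteMeasureOnCompactsQuotient

/-- **The reflection identity for the truncated zeta integral** (Godement–Jacquet (1972), §12–13,
the identity obtained from Poisson summation before the singular terms are disposed of). Let
`Φ ∈ 𝒮(M_n(𝔸_K))`, `Φ̂ = adelicMatrixFourier n K λ Φ`, `φ, φ' ∈ L²(X)`, `Re s ≥ n² + n + 2`, `μ` an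
automorphic measure, `ν` a Haar measure on `GL_n(𝔸_K)`, `β` a Bruhat function for
`H = A_G · GL_n(K)` and its Haar measure `ρ_H`, `ρ_H ↦ κ (α ⊗ #)` under `H ≅ A_G × GL_n(K)` with `α`
an inversion invariant Haar measure on `A_G`, and `c` the unfolding constant. Then, with
`F'' (g) = Φ̂(g⁻¹) |det g|^{s-n} 𝟙_{|det g| < 1}` (`gjDualF … ∘ inv`),
`Z^{<1}(Φ, s, φ, φ') - λ(D_M)⁻¹ ∫_G F''(g) ⟪φ', R(g) φ⟫ dν(g)
   = c ∫_G β(x̃) conj φ'(x̃H) ∫_G β(ỹ) φ(ỹH) (κ ∫_{A_G} (Q' - Q)(x̃, ỹ, a) dα) dν(ỹ) dν(x̃)`,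
`Q' - Q = gjSingDefect`: the regular parts of the theta series cancel fibrewise by Poisson summation,
and only the singular terms remain. For `n = 1` the right-hand side is explicit (poles at `s = 0, 1`);
for `n ≥ 2` it vanishes on cusp forms. [cite: GodementJacquet1972, §12–13] -/
theorem gjZeta_restrict_compl_sub_dual_eq_integral_gjSingDefect
    {Φ : Matrix (Fin n) (Fin n) (AdeleRing (𝓞 K) K) → ℂ} (hΦ : Φ ∈ schwartzBruhatAdelicMatrix n K)
    (φ φ' : (AdelicGroupData.gl n K).L2 μ) {s : ℂ} (hs : (n : ℝ) * n + n + 2 ≤ s.re)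
    {β : (AdelicGroupData.gl n K).Adelic → ℝ}
    (hβ : IsBruhatFunction (AdelicGroupData.gl n K).quotientSubgroup (quotientSubgroupHaar n K) β)
    {α : Measure (AdelicGroupData.gl n K).center'} [α.IsHaarMeasure] [α.IsInvInvariant] {κ : ℝ≥0}
    (hκ : (quotientSubgroupHaar n K).map (quotientSubgroupEquiv n K) =
      κ • α.prod (count : Measure (AdelicGroupData.gl n K).arithmeticSubgroup)) :
    gjZeta μ (ν.restrict (detAtLeastOne n K)ᶜ) Φ φ φ' s -
        ((lam (matrixFundamentalDomain n K)).toReal : ℂ)⁻¹ *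
          ∫ g : GL (Fin n) (AdeleRing (𝓞 K) K),
            gjDualF n K (adelicMatrixFourier n K lam Φ) ((n : ℂ) - s) g⁻¹ * glMatrixCoeff μ φ φ' g ∂ν =
      ((unfoldingConstant (AdelicGroupData.gl n K).quotientSubgroup (quotientSubgroupHaar n K) μ ν : ℝ) : ℂ) *
        ∫ x₀ : (AdelicGroupData.gl n K).Adelic, (β x₀ : ℂ) *
          (conj ((φ' : (AdelicGroupData.gl n K).automorphicQuotient → ℂ) (QuotientGroup.mk x₀)) *
            ∫ y₀ : (AdelicGroupData.gl n K).Adelic, (β y₀ : ℂ) *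
              (((κ : ℝ) • ∫ a, gjSingDefect lam Φ s x₀ y₀ a ∂α) *
                (φ : (AdelicGroupData.gl n K).automorphicQuotient → ℂ) (QuotientGroup.mk y₀)) ∂ν) ∂ν := by
  -- the analytic facts about `φ` and `ψ = conj φ'`
  haveI hinv : ν.IsInvInvariant := isInvInvariant_of_isHaarMeasure_gl n K ν
  haveI : @Measure.IsInvInvariant (GL (Fin n) (AdeleRing (𝓞 K) K)) (glBorel n K) _ ν := hinv
  have hc : unfoldingConstant (AdelicGroupData.gl n K).quotientSubgroup (quotientSubgroupHaar n K) μ ν ≠ 0 :=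
    (automorphicUnfoldingConstant_pos n K μ ν).ne'
  have hφm : StronglyMeasurable (fun x : (AdelicGroupData.gl n K).automorphicQuotient =>
      (φ : (AdelicGroupData.gl n K).automorphicQuotient → ℂ) x) := Lp.stronglyMeasurable φ
  have hφ2 : MemLp (fun x : (AdelicGroupData.gl n K).automorphicQuotient =>
      (φ : (AdelicGroupData.gl n K).automorphicQuotient → ℂ) x) 2 μ := Lp.memLp φ
  have hφ1 : Integrable (fun x : (AdelicGroupData.gl n K).automorphicQuotient =>
      (φ : (AdelicGroupData.gl n K).automorphicQuotient → ℂ) x) μ := hφ2.integrable one_le_two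
  have hψm : StronglyMeasurable (fun x : (AdelicGroupData.gl n K).automorphicQuotient =>
      conj ((φ' : (AdelicGroupData.gl n K).automorphicQuotient → ℂ) x)) :=
    Complex.continuous_conj.comp_stronglyMeasurable (Lp.stronglyMeasurable φ')
  have hψ2 : MemLp (fun x : (AdelicGroupData.gl n K).automorphicQuotient =>
      conj ((φ' : (AdelicGroupData.gl n K).automorphicQuotient → ℂ) x)) 2 μ := memLp_two_conj (Lp.memLp φ')
  -- the two test functions
  have hΨS : adelicMatrixFourier n K lam Φ ∈ schwartzBruhatAdelicMatrix n K :=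
    adelicMatrixFourier_mem_schwartzBruhatAdelicMatrix lam hΦ
  have hFint : Integrable (gjTruncF n K Φ s : (AdelicGroupData.gl n K).Adelic → ℂ) ν := integrable_gjTruncF hΦ hs ν
  have hw : ((n : ℂ) - s).re ≤ (n : ℝ) * n + n + 2 := by
    simp only [Complex.sub_re, Complex.natCast_re]
    nlinarith [hs, sq_nonneg (n : ℝ)]
  have hF''int : Integrable (fun g : (AdelicGroupData.gl n K).Adelic =>
      gjDualF n K (adelicMatrixFourier n K lam Φ) ((n : ℂ) - s) (g⁻¹ : (AdelicGroupData.gl n K).Adelic)) ν :=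
    (integrable_gjDualF hΨS hw ν).comp_inv
  have hF''sm : StronglyMeasurable (fun g : (AdelicGroupData.gl n K).Adelic =>
      gjDualF n K (adelicMatrixFourier n K lam Φ) ((n : ℂ) - s) (g⁻¹ : (AdelicGroupData.gl n K).Adelic)) :=
    (stronglyMeasurable_gjDualF hΨS ((n : ℂ) - s)).comp_measurable
      (continuous_inv (G := (AdelicGroupData.gl n K).Adelic)).measurable
  -- Step A: both `G`-integrals are of the shape `∫ F(g) (∫ ψ φ(g⁻¹ • x)) dg`, and unfold through `β`
  have eZ := integral_mul_integral_mul_comp_smul_eq_mul_integral_integral_bruhat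
    (AdelicGroupData.gl n K).quotientSubgroup (quotientSubgroupHaar n K) μ ν hc hβ hFint hφm hφ2 hφ1 hψm hψ2
  have eM := integral_mul_integral_mul_comp_smul_eq_mul_integral_integral_bruhat
    (AdelicGroupData.gl n K).quotientSubgroup (quotientSubgroupHaar n K) μ ν hc hβ hF''int hφm hφ2 hφ1 hψm hψ2
  beta_reduce at eZ eM
  have hZ : gjZeta μ (ν.restrict (detAtLeastOne n K)ᶜ) Φ φ φ' s =
      ∫ g : (AdelicGroupData.gl n K).Adelic, gjTruncF n K Φ s g *
        (∫ x, conj ((φ' : (AdelicGroupData.gl n K).automorphicQuotient → ℂ) x) *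
          (φ : (AdelicGroupData.gl n K).automorphicQuotient → ℂ) (g⁻¹ • x) ∂μ) ∂ν := by
    rw [← integral_gjTruncF_mul_glMatrixCoeff μ Φ φ φ' s ν]
    refine integral_congr_ae (Eventually.of_forall fun g => ?_)
    exact congrArg (fun t => gjTruncF n K Φ s g * t) (glMatrixCoeff_eq_integral μ φ φ' g)
  have hM : ∫ g : GL (Fin n) (AdeleRing (𝓞 K) K),
      gjDualF n K (adelicMatrixFourier n K lam Φ) ((n : ℂ) - s) g⁻¹ * glMatrixCoeff μ φ φ' g ∂ν =
      ∫ g : (AdelicGroupData.gl n K).Adelic,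
        gjDualF n K (adelicMatrixFourier n K lam Φ) ((n : ℂ) - s) (g⁻¹ : (AdelicGroupData.gl n K).Adelic) *
        (∫ x, conj ((φ' : (AdelicGroupData.gl n K).automorphicQuotient → ℂ) x) *
          (φ : (AdelicGroupData.gl n K).automorphicQuotient → ℂ) (g⁻¹ • x) ∂μ) ∂ν := by
    refine integral_congr_ae (Eventually.of_forall fun g => ?_)
    exact congrArg (fun t => gjDualF n K (adelicMatrixFourier n K lam Φ) ((n : ℂ) - s)
      (g⁻¹ : (AdelicGroupData.gl n K).Adelic) * t) (glMatrixCoeff_eq_integral μ φ φ' g)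
  rw [hZ.trans eZ, hM.trans eM]
  -- Step B: linearity in the outer variable
  have hIZ := integrable_bruhat_mul_mul_integral_bruhat_cosetKernel
    (AdelicGroupData.gl n K).quotientSubgroup (quotientSubgroupHaar n K) μ ν hc hβ hFint hφm hφ2 hφ1 hψm hψ2
  have hIM := integrable_bruhat_mul_mul_integral_bruhat_cosetKernel
    (AdelicGroupData.gl n K).quotientSubgroup (quotientSubgroupHaar n K) μ ν hc hβ hF''int hφm hφ2 hφ1 hψm hψ2
  set L : ℂ := ((lam (matrixFundamentalDomain n K)).toReal : ℂ)⁻¹ with hL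
  rw [show ∀ c A B : ℂ, c * A - L * (c * B) = c * (A - L * B) from fun c A B => by ring,
    ← integral_const_mul L, ← integral_sub hIZ (hIM.const_mul L)]
  congr 1
  -- Step C: for a.e. `x₀`, linearity in the inner variable and the pointwise identity a.e. in `y₀`
  refine integral_congr_ae ?_
  filter_upwards [ae_integrable_bruhat_mul_cosetKernel_mul (AdelicGroupData.gl n K).quotientSubgroup
      (quotientSubgroupHaar n K) μ ν hc hβ hFint hφm hφ1,
    ae_integrable_bruhat_mul_cosetKernel_mul (AdelicGroupData.gl n K).quotientSubgroup
      (quotientSubgroupHaar n K) μ ν hc hβ hF''int hφm hφ1] with x₀ hxZ hxM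
  rw [show ∀ b P A B : ℂ, b * (P * A) - L * (b * (P * B)) = b * (P * (A - L * B)) from
      fun b P A B => by ring,
    ← integral_const_mul L, ← integral_sub hxZ (hxM.const_mul L)]
  congr 2
  refine integral_congr_ae ?_
  -- fibre integrability at `(x₀, y₀)` for a.e. `y₀`
  have hfibZ := ae_comp_mk_of_ae (AdelicGroupData.gl n K).quotientSubgroup (quotientSubgroupHaar n K) μ ν hc
    (ae_integrable_gjTruncF_fiber μ hΦ hs x₀)
  have hfibM := ae_comp_mk_of_ae (AdelicGroupData.gl n K).quotientSubgroup (quotientSubgroupHaar n K) μ ν hc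
    (ae_integrable_comp_mul_inv_mul_inv (AdelicGroupData.gl n K).quotientSubgroup (quotientSubgroupHaar n K) μ ν
      hF''int hF''sm x₀)
  filter_upwards [hfibZ, hfibM] with y₀ hyZ hyM
  have hF := hyZ y₀ rfl
  have hF'' := hyM y₀ rfl
  obtain ⟨-, hpt⟩ := cosetKernel_gjTruncF_sub_eq_smul_integral_gjSingDefect lam hκ hΦ s x₀ y₀ hF hF''
  rw [← hpt]
  simp only [RCLike.ofReal_eq_complex_ofReal]
  ring

end Integrated

end Literature.NumberTheory.Automorphic
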